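/-
Copyright (c) 2026 the pub-hodgecm-mathlib formalisation cell (harness21).  Prover seat hodgecm-mathlib-K2E1-p13 (g2), Track B ∕ K2-LIT, h413 = `stmt-HodgeConjecture-24833`,
line `K2_E1_TraceFormulaBeta`, ROADCARD «5Res ENDGAME BY FAMILIES» C3 (dealer K2E1-plan (g7) (154)∕(163)∕(196)), FILE 1: the functional equation of the `(χ,τ)` scattering data in
COLUMN currency, from two Bernstein–Lapid by-product packages (★ X1_χ `exists_chi_xSystem_byproducts`' clause shapes) — abstract∕rank-generic §1, `U(1,1)_{L∕L⁺}` §2 ((G1) discharged),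
the rank-one (level `K_max`) scalar form §3.  The CM ASSEMBLY on K2E1-p14's §2b∕X2_χ packages is FILE 2.
-/
import Summits.HodgeConjecture.HodgeConjecture.Theorems.K2E1ScatteringFunctionalEquationOfUnique   -- ★ FILE 0 p859915∕ED.2 p860017 (this seat): the matrix engine `sum_smul_eq_of_xSystem_unique_of_datum`
import Summits.HodgeConjecture.HodgeConjecture.Theorems.K2E1SphericalTransformSymmetryU           -- ★ p859498 (G1): `sphericalTransform_symm_cm_two` (`ĥ(z) = ĥ(1 − z)` on `U(1,1)_{L∕L⁺}`)
import HarnessLib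

/-!
# C3 FILE 1 — `K2E1ChiScatteringFunctionalEquationCMTwo`: THE FUNCTIONAL EQUATION `M(1−z; χʷ)·M(z; χ) = 1` OF THE `(χ,τ)` SCATTERING DATA IN COLUMN CURRENCY, FROM UNIQUENESS

Track B ∕ K2-LIT, crux h413 = `stmt-HodgeConjecture-24833`, route of record `HCCMUnconditional`; cell `hodgecm-mathlib`, squad K2, ENGINE E1.  THEOREMS ONLY (no `def`, no `instance`,
no `notation`, no `sorry`; default heartbeats); lane `--supports stmt-HodgeConjecture-24833 --as helper` (count-neutral).

THE MATHEMATICS ([BernsteinLapid2019, §4 Claims 2–5, §5]; [MoeglinWaldspurger1995, IV.1.8–IV.1.10]; [Langlands1976, §7]).  For a section `φ ∈ V(χ, K′, ω)` the Bernstein–Lapid system on a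
ball `D_n` has the constant-term equation `cnst_N(ι ψ) = [f_z^φ] + L(z) b`, `L(z) b = Σ_{j∈ι′} b_j·[f^{φ′_j}_{1−z}]` over a basis `(φ′_j)` of `V(χʷ, K′, ω′)` (★ X1_χ §2a
`K2E1ChiEisensteinDataCMTwo.exists_chi_constantTerm_data_cm_two`), and on the co-discrete holomorphy set `U` the continued solution `(vX(z), cc(z))`, `cc(z) ∈ ι′ → ℂ` = the COLUMN of
the scattering matrix `M(z; χ)` at `φ` (★ X1_χ §1 `K2E1ChiEisensteinMeromorphicExportsU2.exists_chi_xSystem_byproducts`: equations + UNIQUENESS on `U`).  Run this for a basis `(φ_k)_{k∈κ}`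
of `V(χ)` (solutions `(vX_k, cc_k)`), and once for the dual datum `φ′_{j₀}` (a `χʷ`-section; dual basis `(φ_k)`; solution `(vX′, cc′)` on `U′`, `cc′(w) ∈ κ → ℂ`).  At a pair `(z, 1 − z)`
with `z ∈ U`, `1 − z ∈ U′`: the dual Eisenstein vector `vX′(1 − z)` satisfies the `z`-Hecke equations (`ĥ_i(1 − z) = ĥ_i(z)`, ★ (G1)) and its constant term is
`[f^{φ′_{j₀}}_{1−z}] + Σ_k cc′(1−z)_k·[f^{φ_k}_z] = L(z) e_{j₀} + Σ_k cc′(1−z)_k·α₁^{(k)}(z)` (the two SWAP identities), so the ★ matrix engine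
(`K2E1ScatteringFunctionalEquationOfUnique.sum_smul_eq_of_xSystem_unique_of_datum`: `vX′(1−z) − Σ_k cc′(1−z)_k·vX_k(z)` solves the homogeneous system) gives
**`Σ_k cc′(1 − z)_k • cc_k(z) = e_{j₀}`** — the `j₀`-th row of `M(1 − z; χʷ)·M(z; χ) = 1`.  At level `K_max` (M1 datum: `dim V(χ) = dim V(χʷ) = 1`) this is the scalar
`c(1 − z; χʷ)·c(z; χ) = 1` (§3), the `(χ,τ)` twin of ★ T2′ F2 `K2E1ScatteringFunctionalEquationCMTwo`.
* §1 (ABSTRACT, rank-generic; modules over `ℂ`, `LinearMapClass` maps — ★ X1_χ's CLMs fit): **`sum_coeff_smul_coeff_eq_of_packages`** — two packages in EXACTLY ★ `exists_chi_xSystem_byproducts`'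
  conclusion clause shapes (`∀ z ∈ U, (∀ i, T i (vX z) = e i z • vX z) ∧ Cn (vX z) = (1:ℂ) • α₁ z + Lc z (cc z) ∧ Q (vX z) = 0` and the uniqueness clause at one datum), the symmetry
  `e i (ρ − z) = e i z` and the two swap identities as hypotheses ⟹ `∀ z ∈ U, ρ − z ∈ U′ → Σ_k cc′(ρ − z) k • cc k z = u′` (`ρ = 1` at `N = 2`, `ρ = 2` at `N = 3`).
* §2 `U(1,1)_{L∕L⁺}`: **`sum_coeff_smul_coeff_eq_of_packages_cm_two`** — §1 with `e i z = ĥ_i(z) = ∫ h_i·H^z dν_G` for left-`K_U`-invariant `h_i ∈ C_c(G(𝔸))` and the symmetry DISCHARGED by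
  ★ `sphericalTransform_symm_cm_two` (`ρ = 1`).
* §3 RANK ONE (`[Unique κ]`, level `K_max`): **`coeff_smul_coeff_eq_of_packages_cm_two`** (`cc′(1 − z) default • cc default z = u′`) and the scalar evaluation
  **`coeff_mul_coeff_apply_eq_of_packages_cm_two`** (`B = ι′ → ℂ`: `cc′(1 − z) default * cc default z j = u′ j`, `= 1` at `u′ = Pi.single j 1`).
FILE 2 (after K2E1-p14's §2b `K2E1ChiEisensteinBallPackageCMTwo` and X2_χ are ★): the swap identities by `Lp.ext` from §2a's a.e. clauses (`α₁′(1−z) =ᵐ zFun f^{φ′_{j₀}}_{1−z} =ᵐ col_{j₀} z`),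
`Cn := (cnstN …).comp (iota hb)`, `Lc z := Σ_j proj_j.smulRight (col j z)`, `u′ := Pi.single j₀ 1`, then ★ FILE 0 `eqOn_diff_of_eqOn_re_gt` ∕ `mul_eq_one_of_eventually` for the global form.
HONEST LABEL: HC_CM is proved only modulo the 7 printed citations (2 remaining named inputs: hLiu418 = `stmt-HodgeConjecture-24832`, h413 = `stmt-HodgeConjecture-24833`) until rung 0
closes; this file asserts no named fact, closes no socket; count-neutral; hypothesis-first on the two package letter-bundles (★ shapes), nothing else.
[cite: BernsteinLapid2019, §4 Claims 2–5 (pp. 9–10) and §5] [cite: MoeglinWaldspurger1995, IV.1.8–IV.1.10] [cite: Langlands1976, §7]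

## References
* [BernsteinLapid2019] J. Bernstein, E. Lapid, *On the meromorphic continuation of Eisenstein series*, J. AMS 37 (2024), §4 Claims 2–5, §5 (functional equations from uniqueness).
* [MoeglinWaldspurger1995] C. Mœglin, J.-L. Waldspurger, *Spectral decomposition and Eisenstein series* (1995), IV.1.8–IV.1.10 (functional equation of the intertwining operators).
* [Langlands1976] R. P. Langlands, *On the Functional Equations Satisfied by Eisenstein Series*, LNM 544 (1976), §7.
-/

set_option autoImplicit false
set_option linter.dupNamespace false  -- the mandated namespace repeats the summit's segment (`HodgeConjecture.HodgeConjecture`)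

noncomputable section

open MeasureTheory Filter Topology Set NumberField
open scoped NNReal ENNReal
open Literature.NumberTheory.Automorphic Literature.NumberTheory.Automorphic.UnitaryGroup AdelicGroupData
open Summit.HodgeConjecture.HodgeConjecture.Cruxes.H413.K2E1BorelEisensteinU
open Summit.HodgeConjecture.HodgeConjecture.Cruxes.H413.K2E1ScatteringFunctionalEquationOfUnique (sum_smul_eq_of_xSystem_unique_of_datum)
open Summit.HodgeConjecture.HodgeConjecture.Cruxes.H413.K2E1SphericalTransformSymmetryU (sphericalTransform_symm_cm_two)

namespace Summit.HodgeConjecture.HodgeConjecture.Cruxes.H413.K2E1ChiScatteringFunctionalEquationCMTwo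

/-! ## §1 ABSTRACT (rank-generic): two by-product packages, the symmetry of the Hecke scalars and the swap identities give `Σ_k cc′(ρ − z)_k • cc_k(z) = u′` -/

section Abstract

variable {𝓗 𝓦 B X : Type*} [AddCommGroup 𝓗] [Module ℂ 𝓗] [AddCommGroup 𝓦] [Module ℂ 𝓦] [AddCommGroup B] [Module ℂ B] [AddCommGroup X] [Module ℂ X]
  {ι FT FC FQ FL FL' : Type*} [FunLike FT 𝓗 𝓗] [LinearMapClass FT ℂ 𝓗 𝓗] [FunLike FC 𝓗 𝓦] [LinearMapClass FC ℂ 𝓗 𝓦]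
  [FunLike FQ 𝓗 X] [LinearMapClass FQ ℂ 𝓗 X] [FunLike FL B 𝓦] [LinearMapClass FL ℂ B 𝓦]
  {κ : Type*} [Fintype κ] [FunLike FL' (κ → ℂ) 𝓦]

/-- **THE COLUMN FUNCTIONAL EQUATION FROM TWO BY-PRODUCT PACKAGES (abstract).**  `z`-family on `U` (data `α₁ k`, `k ∈ κ` — a basis of `V(χ)`; parameter maps `Lc z : B → 𝓦`; solutions
`(vX k, cc k)` with the three equations for every `k` and UNIQUENESS at one datum `k₀`, all in ★ `exists_chi_xSystem_byproducts`' clause shapes); dual package on `U′` (datum `α₁′`, parameter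
maps `Lc′ w : (κ → ℂ) → 𝓦`, solution `(vX′, cc′)`); symmetry `e i (ρ − z) = e i z` of the Hecke scalars; the SWAP identities `α₁′ (ρ − z) = Lc z u′` and `Lc′ (ρ − z) b′ = Σ_k b′ k • α₁ k z`.
THEN **`∀ z ∈ U, ρ − z ∈ U′ → Σ_k cc′ (ρ − z) k • cc k z = u′`** (★ matrix engine on `vX′(ρ − z)`). [cite: BernsteinLapid2019, §5 and §4 Claim 3] [cite: MoeglinWaldspurger1995, IV.1.10] -/
theorem sum_coeff_smul_coeff_eq_of_packages (ρ : ℂ) (T : ι → FT) (e : ι → ℂ → ℂ) (hsym : ∀ i z, e i (ρ - z) = e i z) (Cn : FC) (Q : FQ)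
    (α₁ : κ → ℂ → 𝓦) (Lc : ℂ → FL) {U : Set ℂ} (vX : κ → ℂ → 𝓗) (cc : κ → ℂ → B)
    (heqs : ∀ k, ∀ z ∈ U, (∀ i, T i (vX k z) = e i z • vX k z) ∧ Cn (vX k z) = (1 : ℂ) • α₁ k z + Lc z (cc k z) ∧ Q (vX k z) = 0)
    (k₀ : κ) (huniq : ∀ z ∈ U, ∀ (ψ : 𝓗) (b : B), (∀ i, T i ψ = e i z • ψ) → Cn ψ = (1 : ℂ) • α₁ k₀ z + Lc z b → Q ψ = 0 → ψ = vX k₀ z ∧ b = cc k₀ z)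
    (α₁' : ℂ → 𝓦) (Lc' : ℂ → FL') {U' : Set ℂ} (vX' : ℂ → 𝓗) (cc' : ℂ → κ → ℂ)
    (heqs' : ∀ w ∈ U', (∀ i, T i (vX' w) = e i w • vX' w) ∧ Cn (vX' w) = (1 : ℂ) • α₁' w + Lc' w (cc' w) ∧ Q (vX' w) = 0)
    (u' : B) (hsw₁ : ∀ z ∈ U, ρ - z ∈ U' → α₁' (ρ - z) = Lc z u') (hsw₂ : ∀ z ∈ U, ρ - z ∈ U' → ∀ b' : κ → ℂ, Lc' (ρ - z) b' = ∑ k, b' k • α₁ k z) :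
    ∀ z ∈ U, ρ - z ∈ U' → ∑ k, cc' (ρ - z) k • cc k z = u' := by
  intro z hz hz'
  have hv'C : Cn (vX' (ρ - z)) = Lc z u' + ∑ k, cc' (ρ - z) k • ((1 : ℂ) • α₁ k z) := by
    rw [(heqs' _ hz').2.1, hsw₁ z hz hz', hsw₂ z hz hz', one_smul]
    simp only [one_smul]
  exact sum_smul_eq_of_xSystem_unique_of_datum T (fun i => e i z) Cn Q (fun k => (1 : ℂ) • α₁ k z) (Lc z)
    (fun k i => (heqs k z hz).1 i) (fun k => (heqs k z hz).2.1) (fun k => (heqs k z hz).2.2) k₀ (huniq z hz)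
    (fun i => by rw [(heqs' _ hz').1 i, hsym]) hv'C (heqs' _ hz').2.2

/-- **RANK ONE (abstract)**: `κ` a singleton (level `K_max`, `dim V(χ) = 1`) — `cc′ (ρ − z) default • cc default z = u′`. [cite: BernsteinLapid2019, §5] -/
theorem coeff_smul_coeff_eq_of_packages [Unique κ] (ρ : ℂ) (T : ι → FT) (e : ι → ℂ → ℂ) (hsym : ∀ i z, e i (ρ - z) = e i z) (Cn : FC) (Q : FQ)
    (α₁ : κ → ℂ → 𝓦) (Lc : ℂ → FL) {U : Set ℂ} (vX : κ → ℂ → 𝓗) (cc : κ → ℂ → B)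
    (heqs : ∀ k, ∀ z ∈ U, (∀ i, T i (vX k z) = e i z • vX k z) ∧ Cn (vX k z) = (1 : ℂ) • α₁ k z + Lc z (cc k z) ∧ Q (vX k z) = 0)
    (huniq : ∀ z ∈ U, ∀ (ψ : 𝓗) (b : B), (∀ i, T i ψ = e i z • ψ) → Cn ψ = (1 : ℂ) • α₁ default z + Lc z b → Q ψ = 0 → ψ = vX default z ∧ b = cc default z)
    (α₁' : ℂ → 𝓦) (Lc' : ℂ → FL') {U' : Set ℂ} (vX' : ℂ → 𝓗) (cc' : ℂ → κ → ℂ)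
    (heqs' : ∀ w ∈ U', (∀ i, T i (vX' w) = e i w • vX' w) ∧ Cn (vX' w) = (1 : ℂ) • α₁' w + Lc' w (cc' w) ∧ Q (vX' w) = 0)
    (u' : B) (hsw₁ : ∀ z ∈ U, ρ - z ∈ U' → α₁' (ρ - z) = Lc z u') (hsw₂ : ∀ z ∈ U, ρ - z ∈ U' → ∀ b' : κ → ℂ, Lc' (ρ - z) b' = ∑ k, b' k • α₁ k z) :
    ∀ z ∈ U, ρ - z ∈ U' → cc' (ρ - z) default • cc default z = u' := fun z hz hz' => by
  rw [← Fintype.sum_unique fun k => cc' (ρ - z) k • cc k z]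
  exact sum_coeff_smul_coeff_eq_of_packages ρ T e hsym Cn Q α₁ Lc vX cc heqs default huniq α₁' Lc' vX' cc' heqs' u' hsw₁ hsw₂ z hz hz'

end Abstract

/-! ## §2 `U(1,1)_{L∕L⁺}`: the Hecke scalars are the spherical transforms, (G1) ★ `sphericalTransform_symm_cm_two` discharges the symmetry (`ρ = 1`) -/

section CMTwo

variable (L : Type) [Field L] [NumberField L] [IsCMField L]
  [MeasurableSpace (quasiSplit (↥(maximalRealSubfield L)) L (IsCMField.complexConj L) 2).Adelic] [BorelSpace (quasiSplit (↥(maximalRealSubfield L)) L (IsCMField.complexConj L) 2).Adelic]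

variable {𝓗 𝓦 B X : Type*} [AddCommGroup 𝓗] [Module ℂ 𝓗] [AddCommGroup 𝓦] [Module ℂ 𝓦] [AddCommGroup B] [Module ℂ B] [AddCommGroup X] [Module ℂ X]
  {ι FT FC FQ FL FL' : Type*} [FunLike FT 𝓗 𝓗] [LinearMapClass FT ℂ 𝓗 𝓗] [FunLike FC 𝓗 𝓦] [LinearMapClass FC ℂ 𝓗 𝓦]
  [FunLike FQ 𝓗 X] [LinearMapClass FQ ℂ 𝓗 X] [FunLike FL B 𝓦] [LinearMapClass FL ℂ B 𝓦]
  {κ : Type*} [Fintype κ] [FunLike FL' (κ → ℂ) 𝓦]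

/-- **THE COLUMN FUNCTIONAL EQUATION ON `U(1,1)_{L∕L⁺}`** — §1 with the Hecke scalars `e i z := ĥ_i(z) = ∫ h_i(x)·H(x)^z dν_G` of left-`K_U`-invariant test functions `h_i ∈ C_c(G(𝔸))`
(★ X1_χ's `hsolT`∕convData_χ currency) and the symmetry `ĥ_i(1 − z) = ĥ_i(z)` DISCHARGED by ★ `sphericalTransform_symm_cm_two`: for the `χ`-family on `U` and the `χʷ`-package on `U′`
with the swap identities, **`∀ z ∈ U, 1 − z ∈ U′ → Σ_k cc′ (1 − z) k • cc k z = u′`**. [cite: BernsteinLapid2019, §5] [cite: MoeglinWaldspurger1995, IV.1.10] [cite: Langlands1976, §7] -/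
theorem sum_coeff_smul_coeff_eq_of_packages_cm_two (νG : Measure (quasiSplit (↥(maximalRealSubfield L)) L (IsCMField.complexConj L) 2).Adelic) [νG.IsHaarMeasure]
    {h : ι → (quasiSplit (↥(maximalRealSubfield L)) L (IsCMField.complexConj L) 2).Adelic → ℂ}
    (hK : ∀ i, ∀ k₁ : (quasiSplit (↥(maximalRealSubfield L)) L (IsCMField.complexConj L) 2).Adelic,
      adelicVal (↥(maximalRealSubfield L)) L (IsCMField.complexConj L) 2 ((StdForm.antidiagonal 2).over L) k₁ ∈ standardMaximalCompactGL 2 L → ∀ x, h i (k₁ * x) = h i x)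
    (hh : ∀ i, Continuous (h i)) (hhs : ∀ i, HasCompactSupport (h i))
    (T : ι → FT) (Cn : FC) (Q : FQ) (α₁ : κ → ℂ → 𝓦) (Lc : ℂ → FL) {U : Set ℂ} (vX : κ → ℂ → 𝓗) (cc : κ → ℂ → B)
    (heqs : ∀ k, ∀ z ∈ U, (∀ i, T i (vX k z) = (∫ x, h i x * (((borelHeight x : ℝ≥0) : ℝ) : ℂ) ^ z ∂νG) • vX k z) ∧ Cn (vX k z) = (1 : ℂ) • α₁ k z + Lc z (cc k z) ∧ Q (vX k z) = 0)
    (k₀ : κ) (huniq : ∀ z ∈ U, ∀ (ψ : 𝓗) (b : B), (∀ i, T i ψ = (∫ x, h i x * (((borelHeight x : ℝ≥0) : ℝ) : ℂ) ^ z ∂νG) • ψ) →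
      Cn ψ = (1 : ℂ) • α₁ k₀ z + Lc z b → Q ψ = 0 → ψ = vX k₀ z ∧ b = cc k₀ z)
    (α₁' : ℂ → 𝓦) (Lc' : ℂ → FL') {U' : Set ℂ} (vX' : ℂ → 𝓗) (cc' : ℂ → κ → ℂ)
    (heqs' : ∀ w ∈ U', (∀ i, T i (vX' w) = (∫ x, h i x * (((borelHeight x : ℝ≥0) : ℝ) : ℂ) ^ w ∂νG) • vX' w) ∧ Cn (vX' w) = (1 : ℂ) • α₁' w + Lc' w (cc' w) ∧ Q (vX' w) = 0)
    (u' : B) (hsw₁ : ∀ z ∈ U, 1 - z ∈ U' → α₁' (1 - z) = Lc z u') (hsw₂ : ∀ z ∈ U, 1 - z ∈ U' → ∀ b' : κ → ℂ, Lc' (1 - z) b' = ∑ k, b' k • α₁ k z) :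
    ∀ z ∈ U, 1 - z ∈ U' → ∑ k, cc' (1 - z) k • cc k z = u' :=
  sum_coeff_smul_coeff_eq_of_packages 1 T (fun i z => ∫ x, h i x * (((borelHeight x : ℝ≥0) : ℝ) : ℂ) ^ z ∂νG)
    (fun i z => (sphericalTransform_symm_cm_two L νG (hK i) (hh i) (hhs i) z).symm) Cn Q α₁ Lc vX cc heqs k₀ huniq α₁' Lc' vX' cc' heqs' u' hsw₁ hsw₂

/-! ## §3 Rank one (level `K_max`, the M1 datum): the scalar functional equation `c(1 − z; χʷ)·c(z; χ) = 1` -/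

/-- **RANK ONE ON `U(1,1)_{L∕L⁺}`** (`κ` a singleton: `dim V(χ) = 1`): `cc′ (1 − z) default • cc default z = u′`. [cite: BernsteinLapid2019, §5] [cite: MoeglinWaldspurger1995, IV.1.10] -/
theorem coeff_smul_coeff_eq_of_packages_cm_two [Unique κ] (νG : Measure (quasiSplit (↥(maximalRealSubfield L)) L (IsCMField.complexConj L) 2).Adelic) [νG.IsHaarMeasure]
    {h : ι → (quasiSplit (↥(maximalRealSubfield L)) L (IsCMField.complexConj L) 2).Adelic → ℂ}
    (hK : ∀ i, ∀ k₁ : (quasiSplit (↥(maximalRealSubfield L)) L (IsCMField.complexConj L) 2).Adelic,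
      adelicVal (↥(maximalRealSubfield L)) L (IsCMField.complexConj L) 2 ((StdForm.antidiagonal 2).over L) k₁ ∈ standardMaximalCompactGL 2 L → ∀ x, h i (k₁ * x) = h i x)
    (hh : ∀ i, Continuous (h i)) (hhs : ∀ i, HasCompactSupport (h i))
    (T : ι → FT) (Cn : FC) (Q : FQ) (α₁ : κ → ℂ → 𝓦) (Lc : ℂ → FL) {U : Set ℂ} (vX : κ → ℂ → 𝓗) (cc : κ → ℂ → B)
    (heqs : ∀ k, ∀ z ∈ U, (∀ i, T i (vX k z) = (∫ x, h i x * (((borelHeight x : ℝ≥0) : ℝ) : ℂ) ^ z ∂νG) • vX k z) ∧ Cn (vX k z) = (1 : ℂ) • α₁ k z + Lc z (cc k z) ∧ Q (vX k z) = 0)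
    (huniq : ∀ z ∈ U, ∀ (ψ : 𝓗) (b : B), (∀ i, T i ψ = (∫ x, h i x * (((borelHeight x : ℝ≥0) : ℝ) : ℂ) ^ z ∂νG) • ψ) →
      Cn ψ = (1 : ℂ) • α₁ default z + Lc z b → Q ψ = 0 → ψ = vX default z ∧ b = cc default z)
    (α₁' : ℂ → 𝓦) (Lc' : ℂ → FL') {U' : Set ℂ} (vX' : ℂ → 𝓗) (cc' : ℂ → κ → ℂ)
    (heqs' : ∀ w ∈ U', (∀ i, T i (vX' w) = (∫ x, h i x * (((borelHeight x : ℝ≥0) : ℝ) : ℂ) ^ w ∂νG) • vX' w) ∧ Cn (vX' w) = (1 : ℂ) • α₁' w + Lc' w (cc' w) ∧ Q (vX' w) = 0)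
    (u' : B) (hsw₁ : ∀ z ∈ U, 1 - z ∈ U' → α₁' (1 - z) = Lc z u') (hsw₂ : ∀ z ∈ U, 1 - z ∈ U' → ∀ b' : κ → ℂ, Lc' (1 - z) b' = ∑ k, b' k • α₁ k z) :
    ∀ z ∈ U, 1 - z ∈ U' → cc' (1 - z) default • cc default z = u' :=
  coeff_smul_coeff_eq_of_packages 1 T (fun i z => ∫ x, h i x * (((borelHeight x : ℝ≥0) : ℝ) : ℂ) ^ z ∂νG)
    (fun i z => (sphericalTransform_symm_cm_two L νG (hK i) (hh i) (hhs i) z).symm) Cn Q α₁ Lc vX cc heqs huniq α₁' Lc' vX' cc' heqs' u' hsw₁ hsw₂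

end CMTwo

/-! ## §3′ Rank one with the column space `B = ι′ → ℂ` (★ X1_χ §2a's currency): the scalar evaluation -/

section ScalarEval

variable {𝓗 𝓦 X : Type*} [AddCommGroup 𝓗] [Module ℂ 𝓗] [AddCommGroup 𝓦] [Module ℂ 𝓦] [AddCommGroup X] [Module ℂ X]
  {ι ι' FT FC FQ FL FL' : Type*} [FunLike FT 𝓗 𝓗] [LinearMapClass FT ℂ 𝓗 𝓗] [FunLike FC 𝓗 𝓦] [LinearMapClass FC ℂ 𝓗 𝓦]
  [FunLike FQ 𝓗 X] [LinearMapClass FQ ℂ 𝓗 X] [FunLike FL (ι' → ℂ) 𝓦] [LinearMapClass FL ℂ (ι' → ℂ) 𝓦]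
  {κ : Type*} [Fintype κ] [Unique κ] [FunLike FL' (κ → ℂ) 𝓦]

/-- **THE SCALAR FUNCTIONAL EQUATION AT THE M1 DATUM (abstract, any `ρ`)**: with the column space `B = ι′ → ℂ` of ★ X1_χ §2a and `κ` a singleton, for every column index `j`,
`cc′ (ρ − z) default * cc default z j = u′ j`; with `u′ = Pi.single j 1` (the dual datum `φ′_j`) the right-hand side is `1`: **`c(ρ − z; χʷ)·c(z; χ) = 1`**.
[cite: BernsteinLapid2019, §5] [cite: MoeglinWaldspurger1995, IV.1.10] [cite: Langlands1976, §7] -/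
theorem coeff_mul_coeff_apply_eq_of_packages (ρ : ℂ) (T : ι → FT) (e : ι → ℂ → ℂ) (hsym : ∀ i z, e i (ρ - z) = e i z) (Cn : FC) (Q : FQ)
    (α₁ : κ → ℂ → 𝓦) (Lc : ℂ → FL) {U : Set ℂ} (vX : κ → ℂ → 𝓗) (cc : κ → ℂ → ι' → ℂ)
    (heqs : ∀ k, ∀ z ∈ U, (∀ i, T i (vX k z) = e i z • vX k z) ∧ Cn (vX k z) = (1 : ℂ) • α₁ k z + Lc z (cc k z) ∧ Q (vX k z) = 0)
    (huniq : ∀ z ∈ U, ∀ (ψ : 𝓗) (b : ι' → ℂ), (∀ i, T i ψ = e i z • ψ) → Cn ψ = (1 : ℂ) • α₁ default z + Lc z b → Q ψ = 0 → ψ = vX default z ∧ b = cc default z)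
    (α₁' : ℂ → 𝓦) (Lc' : ℂ → FL') {U' : Set ℂ} (vX' : ℂ → 𝓗) (cc' : ℂ → κ → ℂ)
    (heqs' : ∀ w ∈ U', (∀ i, T i (vX' w) = e i w • vX' w) ∧ Cn (vX' w) = (1 : ℂ) • α₁' w + Lc' w (cc' w) ∧ Q (vX' w) = 0)
    (u' : ι' → ℂ) (hsw₁ : ∀ z ∈ U, ρ - z ∈ U' → α₁' (ρ - z) = Lc z u') (hsw₂ : ∀ z ∈ U, ρ - z ∈ U' → ∀ b' : κ → ℂ, Lc' (ρ - z) b' = ∑ k, b' k • α₁ k z)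
    {z : ℂ} (hz : z ∈ U) (hz' : ρ - z ∈ U') (j : ι') :
    cc' (ρ - z) default * cc default z j = u' j := by
  have h := coeff_smul_coeff_eq_of_packages ρ T e hsym Cn Q α₁ Lc vX cc heqs huniq α₁' Lc' vX' cc' heqs' u' hsw₁ hsw₂ z hz hz'
  have hj := congrFun h j
  rwa [Pi.smul_apply, smul_eq_mul] at hj

end ScalarEval

end Summit.HodgeConjecture.HodgeConjecture.Cruxes.H413.K2E1ChiScatteringFunctionalEquationCMTwo

end
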